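import Summits.ValiantsHypothesis.ValiantsHypothesis.Theorems.SymPencilPerFourW2Lever
import Summits.ValiantsHypothesis.ValiantsHypothesis.Theorems.SymPencilPerFourW2Columns

/-!
# Route `SymPencil` — the space `W₂ = row 0 ⊕ span(E₁₀, E₁₁)` at size `27`, V: the two levers
# (`--supports` stmt-ValiantsHypothesis-5674 `SdcSuperquadratic`; cell `(10,6,6)`; rung currency
# only, nothing here bears on `VP ≠ VNP`)

Instances of `SymPencilPerFourW2Lever.w2_lever_core`: the shift forms of the directions
`a = E₀₁+E₀₂+E₀₃` (`w2_forms_vanish_a`: `F¹ = F² = 0`) and `b = E₁₀` (`w2_forms_vanish_b`: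
`Q₂₃ = Q₁₃ = Q₁₂ = 0`) vanish on the lever spaces (`SymPencilAffineKernelLever.shift_invariance_of_affine`
with the shifts of `W₂` and `SymPencilPerFourW2Forms.per_shift_w2_a/b`), whence, with the
classifications `w2_classify_a` / `w2_classify_b`: `K_a = bU (X⁺)` or `bU (X⁻)` (`w2_lever_a`) and
`K_b = bU (Y⁺)` or `bU (Y⁻)` (`w2_lever_b`).  `Cruxes/SdcSuperquadratic/PENCIL-CROSS-27.md` rev 6
§W₂.  No definitions, no named facts. [folklore]
-/

noncomputable section

-- single-conjunct layout: Sub = Summit, duplicated namespace component intended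
set_option linter.dupNamespace false

namespace Summit.ValiantsHypothesis.ValiantsHypothesis.Theorems.SymPencilPerFourW2Levers

open Matrix MvPolynomial Module
open Literature.Computability.AlgebraicComplexity
open Summit.ValiantsHypothesis.ValiantsHypothesis.Theorems.SymPencilAffineKernelLever
open Summit.ValiantsHypothesis.ValiantsHypothesis.Theorems.SymPencilSdcPerFourTwentySeven
open Summit.ValiantsHypothesis.ValiantsHypothesis.Theorems.SymPencilPerFourW2Forms
open Summit.ValiantsHypothesis.ValiantsHypothesis.Theorems.SymPencilPerFourW2Columns
open Summit.ValiantsHypothesis.ValiantsHypothesis.Theorems.SymPencilPerFourW2Lever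

universe u

variable {k : Type u} [Field k]

/-- `a = E₀₁+E₀₂+E₀₃` lives in row `0`. [folklore] -/
theorem w2_a_row (t : k) (i j : Fin 4) (hi : i ≠ 0) : (t • (fun z : Fin 4 × Fin 4 =>
          (Matrix.of ![![0, 1, 1, 1], ![0, 0, 0, 0], ![0, 0, 0, 0], ![0, 0, 0, 0]]) z.1 z.2)) (i, j) = 0 := by
  rw [Pi.smul_apply, smul_eq_mul]
  fin_cases i
  · exact absurd rfl hi
  all_goals fin_cases j <;> simp

/-- `b = E₁₀` lives in row `1`. [folklore] -/
theorem w2_b_row (t : k) (i j : Fin 4) (hi : i ≠ 1) : (t • (fun z : Fin 4 × Fin 4 =>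
          (Matrix.of ![![0, 0, 0, 0], ![1, 0, 0, 0], ![0, 0, 0, 0], ![0, 0, 0, 0]]) z.1 z.2)) (i, j) = 0 := by
  rw [Pi.smul_apply, smul_eq_mul]
  fin_cases i
  · fin_cases j <;> simp
  · exact absurd rfl hi
  all_goals fin_cases j <;> simp

/-- `t a` is supported on `W₂`. [folklore] -/
theorem w2_a_support (t : k) :
    ∀ z : Fin 4 × Fin 4, ¬ (z.1 = 0 ∨ z = (1, 0) ∨ z = (1, 1)) → (t • (fun z : Fin 4 × Fin 4 =>
          (Matrix.of ![![0, 1, 1, 1], ![0, 0, 0, 0], ![0, 0, 0, 0], ![0, 0, 0, 0]]) z.1 z.2)) z = 0 := by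
  intro z hz
  obtain ⟨i, j⟩ := z
  exact w2_a_row t i j fun h => hz (Or.inl h)

/-- `t b` is supported on `W₂`. [folklore] -/
theorem w2_b_support (t : k) :
    ∀ z : Fin 4 × Fin 4, ¬ (z.1 = 0 ∨ z = (1, 0) ∨ z = (1, 1)) → (t • (fun z : Fin 4 × Fin 4 =>
          (Matrix.of ![![0, 0, 0, 0], ![1, 0, 0, 0], ![0, 0, 0, 0], ![0, 0, 0, 0]]) z.1 z.2)) z = 0 := by
  intro z hz
  obtain ⟨i, j⟩ := z
  rw [Pi.smul_apply, smul_eq_mul]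
  by_cases h : (i = 0 ∨ (i, j) = ((1 : Fin 4), (0 : Fin 4)) ∨ (i, j) = ((1 : Fin 4), (1 : Fin 4)))
  · exact absurd h hz
  · fin_cases i <;> fin_cases j <;> simp at h ⊢

/-- The shifts `pE₁₀ + qE₁₁` are supported on `W₂`. [folklore] -/
theorem w2_shift_row1_support (p q : k) :
    ∀ z : Fin 4 × Fin 4, ¬ (z.1 = 0 ∨ z = (1, 0) ∨ z = (1, 1)) → (fun z : Fin 4 × Fin 4 =>
      (Matrix.of ![![0, 0, 0, 0], ![p, q, 0, 0], ![0, 0, 0, 0], ![0, 0, 0, 0]]) z.1 z.2) z = 0 := by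
  intro z hz
  obtain ⟨i, j⟩ := z
  by_cases h : (i = 0 ∨ (i, j) = ((1 : Fin 4), (0 : Fin 4)) ∨ (i, j) = ((1 : Fin 4), (1 : Fin 4)))
  · exact absurd h hz
  · fin_cases i <;> fin_cases j <;> simp at h ⊢

/-- The shifts `α ∈ row 0` are supported on `W₂`. [folklore] -/
theorem w2_shift_row0_support (α₀ α₁ α₂ α₃ : k) :
    ∀ z : Fin 4 × Fin 4, ¬ (z.1 = 0 ∨ z = (1, 0) ∨ z = (1, 1)) → (fun z : Fin 4 × Fin 4 =>
      (Matrix.of ![![α₀, α₁, α₂, α₃], ![0, 0, 0, 0], ![0, 0, 0, 0], ![0, 0, 0, 0]]) z.1 z.2) z = 0 := by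
  intro z hz
  obtain ⟨i, j⟩ := z
  by_cases h : (i = 0 ∨ (i, j) = ((1 : Fin 4), (0 : Fin 4)) ∨ (i, j) = ((1 : Fin 4), (1 : Fin 4)))
  · exact absurd h hz
  · fin_cases i <;> fin_cases j <;> simp at h ⊢

variable [CharZero k] {ι' : Type*} [Fintype ι'] [DecidableEq ι']

/-- **The `a`-lever of `W₂` kills `F¹, F²`.** [folklore] -/
theorem w2_forms_vanish_a {D : Matrix ι' ι' k} (hDs : Dᵀ = D)
    (bL : (Fin 4 × Fin 4 → k) →ₗ[k] (ι' → k)) (CL : (Fin 4 × Fin 4 → k) →ₗ[k] Matrix ι' ι' k)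
    (hCs : ∀ z, (CL z)ᵀ = CL z) {κ : k} (hκ : κ ≠ 0)
    (hii : ∀ z, bL z ⬝ᵥ (D⁻¹ * CL z * D⁻¹) *ᵥ bL z = 0)
    (hN : ∀ v, bL v = 0 → IsUnit (D + CL v).det ∧ ∀ (z : Fin 4 × Fin 4 → k) (s : k),
      κ * MvPolynomial.eval (v + s • z) (perPoly (Fin 4) k) =
        (Matrix.fromBlocks ((s * 0) • (1 : Matrix Unit Unit k))
          (Matrix.replicateRow Unit (s • bL z)) (Matrix.replicateCol Unit (s • bL z))
          (D + CL v + s • CL z)).det)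
    (hker : ∀ x : Fin 4 × Fin 4 → k,
      bL x = 0 ↔ ∀ z : Fin 4 × Fin 4, ¬ (z.1 = 0 ∨ z = (1, 0) ∨ z = (1, 1)) → x z = 0)
    (t : k) (ht : t ≠ 0) (x z₀ : Fin 4 × Fin 4 → k)
    (hx : (D + CL (t • (fun z : Fin 4 × Fin 4 =>
          (Matrix.of ![![0, 1, 1, 1], ![0, 0, 0, 0], ![0, 0, 0, 0], ![0, 0, 0, 0]]) z.1 z.2)))⁻¹ *ᵥ bL x = D⁻¹ *ᵥ bL z₀) :
    x (2, 1) * (x (3, 2) + x (3, 3)) + x (2, 2) * (x (3, 1) + x (3, 3)) +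
        x (2, 3) * (x (3, 1) + x (3, 2)) = 0 ∧
      x (2, 0) * (x (3, 2) + x (3, 3)) + x (3, 0) * (x (2, 2) + x (2, 3)) = 0 := by
  have hd_ker : bL (t • (fun z : Fin 4 × Fin 4 =>
          (Matrix.of ![![0, 1, 1, 1], ![0, 0, 0, 0], ![0, 0, 0, 0], ![0, 0, 0, 0]]) z.1 z.2)) = 0 := (hker _).2 (w2_a_support t)
  have haff : ∀ z : Fin 4 × Fin 4 → k, ∃ e₀ e₁ : k, ∀ s : k,
      MvPolynomial.eval (z + s • (t • (fun z : Fin 4 × Fin 4 =>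
          (Matrix.of ![![0, 1, 1, 1], ![0, 0, 0, 0], ![0, 0, 0, 0], ![0, 0, 0, 0]]) z.1 z.2))) (perPoly (Fin 4) k) = e₀ + s * e₁ := fun z =>
    affine_of_row k 0 _ (fun i j hi => w2_a_row t i j hi) z
  have key : ∀ p q : k, t * (p * (x (2, 1) * (x (3, 2) + x (3, 3)) + x (2, 2) * (x (3, 1) + x (3, 3)) +
      x (2, 3) * (x (3, 1) + x (3, 2))) +
      q * (x (2, 0) * (x (3, 2) + x (3, 3)) + x (3, 0) * (x (2, 2) + x (2, 3)))) = 0 := by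
    intro p q
    have h := shift_invariance_of_affine hDs bL CL hCs hκ hii hN _ hd_ker haff x z₀ hx _
      ((hker _).2 (w2_shift_row1_support p q))
    have e := per_shift_w2_a x p q t
    rw [h, sub_self] at e
    linear_combination -e
  have e1 := key 1 0
  have e2 := key 0 1
  constructor
  · have h := (mul_eq_zero.1 e1).resolve_left ht
    linear_combination h
  · have h := (mul_eq_zero.1 e2).resolve_left ht
    linear_combination h

/-- **The `b`-lever of `W₂` kills `Q₂₃, Q₁₃, Q₁₂`.** [folklore] -/
theorem w2_forms_vanish_b {D : Matrix ι' ι' k} (hDs : Dᵀ = D)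
    (bL : (Fin 4 × Fin 4 → k) →ₗ[k] (ι' → k)) (CL : (Fin 4 × Fin 4 → k) →ₗ[k] Matrix ι' ι' k)
    (hCs : ∀ z, (CL z)ᵀ = CL z) {κ : k} (hκ : κ ≠ 0)
    (hii : ∀ z, bL z ⬝ᵥ (D⁻¹ * CL z * D⁻¹) *ᵥ bL z = 0)
    (hN : ∀ v, bL v = 0 → IsUnit (D + CL v).det ∧ ∀ (z : Fin 4 × Fin 4 → k) (s : k),
      κ * MvPolynomial.eval (v + s • z) (perPoly (Fin 4) k) =
        (Matrix.fromBlocks ((s * 0) • (1 : Matrix Unit Unit k))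
          (Matrix.replicateRow Unit (s • bL z)) (Matrix.replicateCol Unit (s • bL z))
          (D + CL v + s • CL z)).det)
    (hker : ∀ x : Fin 4 × Fin 4 → k,
      bL x = 0 ↔ ∀ z : Fin 4 × Fin 4, ¬ (z.1 = 0 ∨ z = (1, 0) ∨ z = (1, 1)) → x z = 0)
    (t : k) (ht : t ≠ 0) (x z₀ : Fin 4 × Fin 4 → k)
    (hx : (D + CL (t • (fun z : Fin 4 × Fin 4 =>
          (Matrix.of ![![0, 0, 0, 0], ![1, 0, 0, 0], ![0, 0, 0, 0], ![0, 0, 0, 0]]) z.1 z.2)))⁻¹ *ᵥ bL x = D⁻¹ *ᵥ bL z₀) :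
    x (2, 2) * x (3, 3) + x (2, 3) * x (3, 2) = 0 ∧
      x (2, 1) * x (3, 3) + x (2, 3) * x (3, 1) = 0 ∧
      x (2, 1) * x (3, 2) + x (2, 2) * x (3, 1) = 0 := by
  have hd_ker : bL (t • (fun z : Fin 4 × Fin 4 =>
          (Matrix.of ![![0, 0, 0, 0], ![1, 0, 0, 0], ![0, 0, 0, 0], ![0, 0, 0, 0]]) z.1 z.2)) = 0 := (hker _).2 (w2_b_support t)
  have haff : ∀ z : Fin 4 × Fin 4 → k, ∃ e₀ e₁ : k, ∀ s : k,
      MvPolynomial.eval (z + s • (t • (fun z : Fin 4 × Fin 4 =>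
          (Matrix.of ![![0, 0, 0, 0], ![1, 0, 0, 0], ![0, 0, 0, 0], ![0, 0, 0, 0]]) z.1 z.2))) (perPoly (Fin 4) k) = e₀ + s * e₁ := fun z =>
    affine_of_row k 1 _ (fun i j hi => w2_b_row t i j hi) z
  have key : ∀ α₁ α₂ α₃ : k, t * (α₁ * (x (2, 2) * x (3, 3) + x (2, 3) * x (3, 2)) +
      α₂ * (x (2, 1) * x (3, 3) + x (2, 3) * x (3, 1)) +
      α₃ * (x (2, 1) * x (3, 2) + x (2, 2) * x (3, 1))) = 0 := by
    intro α₁ α₂ α₃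
    have h := shift_invariance_of_affine hDs bL CL hCs hκ hii hN _ hd_ker haff x z₀ hx _
      ((hker _).2 (w2_shift_row0_support 0 α₁ α₂ α₃))
    have e := per_shift_w2_b x 0 α₁ α₂ α₃ t
    rw [h, sub_self] at e
    linear_combination -e
  have e1 := key 1 0 0
  have e2 := key 0 1 0
  have e3 := key 0 0 1
  refine ⟨?_, ?_, ?_⟩
  · have h := (mul_eq_zero.1 e1).resolve_left ht
    linear_combination h
  · have h := (mul_eq_zero.1 e2).resolve_left ht
    linear_combination h
  · have h := (mul_eq_zero.1 e3).resolve_left ht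
    linear_combination h

/-- **The `a`-lever of `W₂`**: `dim K_a ≥ 7` and `K_a ⊆ bU (X⁺)` or `K_a ⊆ bU (X⁻)`. [folklore] -/
theorem w2_lever_a {D : Matrix ι' ι' k} (hD : IsUnit D.det) (hDs : Dᵀ = D)
    (bL : (Fin 4 × Fin 4 → k) →ₗ[k] (ι' → k)) (CL : (Fin 4 × Fin 4 → k) →ₗ[k] Matrix ι' ι' k)
    (hCs : ∀ z, (CL z)ᵀ = CL z) {κ : k} (hκ : κ ≠ 0)
    (hii : ∀ z, bL z ⬝ᵥ (D⁻¹ * CL z * D⁻¹) *ᵥ bL z = 0)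
    (hN : ∀ v, bL v = 0 → IsUnit (D + CL v).det ∧ ∀ (z : Fin 4 × Fin 4 → k) (s : k),
      κ * MvPolynomial.eval (v + s • z) (perPoly (Fin 4) k) =
        (Matrix.fromBlocks ((s * 0) • (1 : Matrix Unit Unit k))
          (Matrix.replicateRow Unit (s • bL z)) (Matrix.replicateCol Unit (s • bL z))
          (D + CL v + s • CL z)).det)
    (hker : ∀ x : Fin 4 × Fin 4 → k,
      bL x = 0 ↔ ∀ z : Fin 4 × Fin 4, ¬ (z.1 = 0 ∨ z = (1, 0) ∨ z = (1, 1)) → x z = 0)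
    (h10 : 10 ≤ finrank k (LinearMap.range bL)) (hcard : Fintype.card ι' ≤ 26) :
    7 ≤ finrank k (LinearMap.range bL ⊓ (LinearMap.range bL).comap (CL (fun z : Fin 4 × Fin 4 =>
          (Matrix.of ![![0, 1, 1, 1], ![0, 0, 0, 0], ![0, 0, 0, 0], ![0, 0, 0, 0]]) z.1 z.2) * D⁻¹).mulVecLin :
        Submodule k (ι' → k)) ∧
    ((∀ y ∈ (LinearMap.range bL ⊓ (LinearMap.range bL).comap (CL (fun z : Fin 4 × Fin 4 =>
          (Matrix.of ![![0, 1, 1, 1], ![0, 0, 0, 0], ![0, 0, 0, 0], ![0, 0, 0, 0]]) z.1 z.2) * D⁻¹).mulVecLin :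
        Submodule k (ι' → k)), ∃ u : (Fin 2 × Fin 3 → k) × (Fin 4 → k),
        (u.1 (1, 1) = 0 ∧ u.1 (1, 2) = 0 ∧ u.1 (0, 1) + u.1 (0, 2) = 0) ∧ y = bL (fun z : Fin 4 × Fin 4 => (Matrix.of ![![0, 0, 0, 0], ![0, 0, u.2 0, u.2 1],
        ![u.2 2, u.1 (0, 0), u.1 (0, 1), u.1 (0, 2)], ![u.2 3, u.1 (1, 0), u.1 (1, 1), u.1 (1, 2)]])
        z.1 z.2)) ∨
     (∀ y ∈ (LinearMap.range bL ⊓ (LinearMap.range bL).comap (CL (fun z : Fin 4 × Fin 4 =>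
          (Matrix.of ![![0, 1, 1, 1], ![0, 0, 0, 0], ![0, 0, 0, 0], ![0, 0, 0, 0]]) z.1 z.2) * D⁻¹).mulVecLin :
        Submodule k (ι' → k)), ∃ u : (Fin 2 × Fin 3 → k) × (Fin 4 → k),
        (u.1 (0, 1) = 0 ∧ u.1 (0, 2) = 0 ∧ u.1 (1, 1) + u.1 (1, 2) = 0) ∧ y = bL (fun z : Fin 4 × Fin 4 => (Matrix.of ![![0, 0, 0, 0], ![0, 0, u.2 0, u.2 1],
        ![u.2 2, u.1 (0, 0), u.1 (0, 1), u.1 (0, 2)], ![u.2 3, u.1 (1, 0), u.1 (1, 1), u.1 (1, 2)]])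
        z.1 z.2))) := by
  refine w2_lever_core hD hDs bL CL hCs hκ hN hker h10 hcard _ 0 (fun t i j hi => w2_a_row t i j hi)
    (fun t => (hker _).2 (w2_a_support t)) _ _ ?_ ?_ ?_
  · intro c₁ c₂ u w hu hw
    simp only [Prod.fst_add, Prod.smul_fst, Pi.add_apply, Pi.smul_apply, smul_eq_mul]
    refine ⟨?_, ?_, ?_⟩
    · rw [hu.1, hw.1]; ring
    · rw [hu.2.1, hw.2.1]; ring
    · linear_combination c₁ * hu.2.2 + c₂ * hw.2.2
  · intro c₁ c₂ u w hu hw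
    simp only [Prod.fst_add, Prod.smul_fst, Pi.add_apply, Pi.smul_apply, smul_eq_mul]
    refine ⟨?_, ?_, ?_⟩
    · rw [hu.1, hw.1]; ring
    · rw [hu.2.1, hw.2.1]; ring
    · linear_combination c₁ * hu.2.2 + c₂ * hw.2.2
  · intro t ht S h7 hxS
    refine w2_classify_a S (fun u hu => ?_) (fun u hu => ?_) h7
    · obtain ⟨z₀, hx⟩ := hxS u hu
      have h := (w2_forms_vanish_a hDs bL CL hCs hκ hii hN hker t ht _ z₀ hx).1
      simpa only [Matrix.of_apply, Matrix.cons_val] using h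
    · obtain ⟨z₀, hx⟩ := hxS u hu
      have h := (w2_forms_vanish_a hDs bL CL hCs hκ hii hN hker t ht _ z₀ hx).2
      simpa only [Matrix.of_apply, Matrix.cons_val] using h

/-- **The `b`-lever of `W₂`**: `dim K_b ≥ 7` and `K_b ⊆ bU (Y⁺)` or `K_b ⊆ bU (Y⁻)`. [folklore] -/
theorem w2_lever_b {D : Matrix ι' ι' k} (hD : IsUnit D.det) (hDs : Dᵀ = D)
    (bL : (Fin 4 × Fin 4 → k) →ₗ[k] (ι' → k)) (CL : (Fin 4 × Fin 4 → k) →ₗ[k] Matrix ι' ι' k)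
    (hCs : ∀ z, (CL z)ᵀ = CL z) {κ : k} (hκ : κ ≠ 0)
    (hii : ∀ z, bL z ⬝ᵥ (D⁻¹ * CL z * D⁻¹) *ᵥ bL z = 0)
    (hN : ∀ v, bL v = 0 → IsUnit (D + CL v).det ∧ ∀ (z : Fin 4 × Fin 4 → k) (s : k),
      κ * MvPolynomial.eval (v + s • z) (perPoly (Fin 4) k) =
        (Matrix.fromBlocks ((s * 0) • (1 : Matrix Unit Unit k))
          (Matrix.replicateRow Unit (s • bL z)) (Matrix.replicateCol Unit (s • bL z))
          (D + CL v + s • CL z)).det)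
    (hker : ∀ x : Fin 4 × Fin 4 → k,
      bL x = 0 ↔ ∀ z : Fin 4 × Fin 4, ¬ (z.1 = 0 ∨ z = (1, 0) ∨ z = (1, 1)) → x z = 0)
    (h10 : 10 ≤ finrank k (LinearMap.range bL)) (hcard : Fintype.card ι' ≤ 26) :
    7 ≤ finrank k (LinearMap.range bL ⊓ (LinearMap.range bL).comap (CL (fun z : Fin 4 × Fin 4 =>
          (Matrix.of ![![0, 0, 0, 0], ![1, 0, 0, 0], ![0, 0, 0, 0], ![0, 0, 0, 0]]) z.1 z.2) * D⁻¹).mulVecLin :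
        Submodule k (ι' → k)) ∧
    ((∀ y ∈ (LinearMap.range bL ⊓ (LinearMap.range bL).comap (CL (fun z : Fin 4 × Fin 4 =>
          (Matrix.of ![![0, 0, 0, 0], ![1, 0, 0, 0], ![0, 0, 0, 0], ![0, 0, 0, 0]]) z.1 z.2) * D⁻¹).mulVecLin :
        Submodule k (ι' → k)), ∃ u : (Fin 2 × Fin 3 → k) × (Fin 4 → k),
        (∀ j : Fin 3, u.1 (0, j) = 0) ∧ y = bL (fun z : Fin 4 × Fin 4 => (Matrix.of ![![0, 0, 0, 0], ![0, 0, u.2 0, u.2 1],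
        ![u.2 2, u.1 (0, 0), u.1 (0, 1), u.1 (0, 2)], ![u.2 3, u.1 (1, 0), u.1 (1, 1), u.1 (1, 2)]])
        z.1 z.2)) ∨
     (∀ y ∈ (LinearMap.range bL ⊓ (LinearMap.range bL).comap (CL (fun z : Fin 4 × Fin 4 =>
          (Matrix.of ![![0, 0, 0, 0], ![1, 0, 0, 0], ![0, 0, 0, 0], ![0, 0, 0, 0]]) z.1 z.2) * D⁻¹).mulVecLin :
        Submodule k (ι' → k)), ∃ u : (Fin 2 × Fin 3 → k) × (Fin 4 → k),
        (∀ j : Fin 3, u.1 (1, j) = 0) ∧ y = bL (fun z : Fin 4 × Fin 4 => (Matrix.of ![![0, 0, 0, 0], ![0, 0, u.2 0, u.2 1],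
        ![u.2 2, u.1 (0, 0), u.1 (0, 1), u.1 (0, 2)], ![u.2 3, u.1 (1, 0), u.1 (1, 1), u.1 (1, 2)]])
        z.1 z.2))) := by
  refine w2_lever_core hD hDs bL CL hCs hκ hN hker h10 hcard _ 1 (fun t i j hi => w2_b_row t i j hi)
    (fun t => (hker _).2 (w2_b_support t)) _ _ ?_ ?_ ?_
  · intro c₁ c₂ u w hu hw j
    simp only [Prod.fst_add, Prod.smul_fst, Pi.add_apply, Pi.smul_apply, smul_eq_mul, hu j, hw j,
      mul_zero, add_zero]
  · intro c₁ c₂ u w hu hw j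
    simp only [Prod.fst_add, Prod.smul_fst, Pi.add_apply, Pi.smul_apply, smul_eq_mul, hu j, hw j,
      mul_zero, add_zero]
  · intro t ht S h7 hxS
    refine w2_classify_b S (fun u hu j j' hjj' => ?_) h7
    obtain ⟨z₀, hx⟩ := hxS u hu
    obtain ⟨h23, h13, h12⟩ := w2_forms_vanish_b hDs bL CL hCs hκ hii hN hker t ht _ z₀ hx
    simp only [Matrix.of_apply, Matrix.cons_val] at h23 h13 h12
    have hj3 : ∀ i : Fin 3, i = 0 ∨ i = 1 ∨ i = 2 := by
      intro i; fin_cases i <;> simp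
    rcases hj3 j with rfl | rfl | rfl <;> rcases hj3 j' with rfl | rfl | rfl
    all_goals first
      | exact absurd rfl hjj'
      | linear_combination h12
      | linear_combination h13
      | linear_combination h23

end Summit.ValiantsHypothesis.ValiantsHypothesis.Theorems.SymPencilPerFourW2Levers

end
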